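/-
Copyright (c) 2026. All rights reserved.
Released under Apache 2.0 license as described in the file LICENSE.
Authors: abc-iut cell, prover seat abc-iut-w5-d038 (gen 8; PROOF-ONLY bricks for the «(FC) topological
step» of the [AbsTopIII] Prop 4.2 (i) geometric column, row «FC-TOPOLOGICAL»: 2×2 eigenline algebra,
the chart end at a puncture with its formula, integer monodromy of a lifted end).
-/
import Literature.AnabelianGeometry.AbsoluteAnabelian.ArchimedeanHolFieldFunctorGeometricPSLCuspParabolicPuncture
import HarnessLib

/-!
# Bricks for «punctures exhaust the cusps»: eigenlines, the chart end, integer monodromy (PROOF-ONLY)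

Classical input for S. Mochizuki, *Topics in Absolute Anabelian Geometry III*, proof of Prop. 4.2 (i)
(p. 106): at the uniformised model `X = ℍ/Λ̄` of a hyperbolic Riemann surface of finite type,
`N_{PSL₂(ℝ)}(Λ̄)/Λ̄` is finite — in the tree via abc-iut-L4-d1's
`HolRS.finiteIndex_subgroupOf_normalizer_of_cusps` from (P) + (FC).  Three self-contained bricks for the
(FC) assembly (`…PSLCuspClasses.lean`), after H. M. Farkas, I. Kra, *Riemann Surfaces* IV.5–IV.6 and
G. Shimura, *Introduction to the Arithmetic Theory of Automorphic Functions* §1.3–1.5: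

* §1 `2 × 2` EIGENLINE ALGEBRA over `ℝ`: an eigenvalue of a parabolic matrix is `tr/2`
  (`eigenvalue_eq_half_trace_of_isParabolic`); two eigenvectors of a NON-SCALAR matrix for the same
  eigenvalue are proportional (`exists_smul_eq_of_mulVec_eq_smul`); hence ★ `exists_smul_eq_of_zpow`
  — if two PARABOLIC powers `Qⁿ¹`, `Qⁿ²` of one `Q ∈ SL(2, ℝ)` have eigenvectors `x₁`, `x₂`, then
  `x₂ ∈ ℝ x₁` (commuting parabolics share their eigenline);
* §2 ★ `HolRS.exists_chartEnd` — the CHART END at a puncture `s ∉ U` of a connected open `U ⊆ M`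
  (abc-iut-w6-d031's `exists_end_ofOpens_puncture`, p476737, with its FORMULA exported):
  `G τ = (chart at s)⁻¹ (φ s + (r/2) e^{2πiτ})`, holomorphic into `U`, `1`-periodic, together with the
  radius `r` and the chart data the comparison argument needs;
* §3 `HolRS.smul_zpow_of_deck` — INTEGER MONODROMY: if a lift `F̃` satisfies `F̃ (τ + 1) = q • F̃ τ` then
  `F̃ (τ + n) = qⁿ • F̃ τ` for all `n ∈ ℤ`.

PROOF-ONLY (no definition, no instance, no named fact); MODEL side of [AbsTopIII] §4; classical; nothing
here bears on the disputed [IUTchIII] Cor. 3.12.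

## References

* S. Mochizuki, *Topics in Absolute Anabelian Geometry III* (2015), proof of Prop. 4.2 (i) p.106,
  Def. 4.1 (i) p.101. [MochizukiAbsTopIII2015]
* H. M. Farkas, I. Kra, *Riemann Surfaces*, 2nd ed. (1992), IV.5.5–IV.5.6, IV.6. [FarkasKra1992]
* G. Shimura, *Introduction to the Arithmetic Theory of Automorphic Functions* (1971), §1.3–1.5. [Shimura1971]
-/

set_option autoImplicit false

noncomputable section

open Complex Filter Topology Metric Set Function
open scoped UpperHalfPlane MatrixGroups Matrix Manifold ContDiff Real
open _root_.TopologicalSpace (Opens)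
open UpperHalfPlane (upperHalfPlaneSet isOpen_upperHalfPlaneSet)
open Literature.Analysis.Complex.TranslationEquivariant

namespace Literature.AnabelianGeometry.AbsoluteAnabelian

namespace HolRS

/-! ### §1 Eigenlines of `2 × 2` real matrices -/

/-- The two coordinates of `P *ᵥ x = e • x`. [cite: Shimura1971, §1.3] -/
theorem mulVec_eq_smul_iff (P : Matrix (Fin 2) (Fin 2) ℝ) (x : Fin 2 → ℝ) (e : ℝ) :
    P *ᵥ x = e • x ↔ P 0 0 * x 0 + P 0 1 * x 1 = e * x 0 ∧ P 1 0 * x 0 + P 1 1 * x 1 = e * x 1 := by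
  constructor
  · intro h
    have h0 := congrFun h 0
    have h1 := congrFun h 1
    simp [Matrix.mulVec, dotProduct, Fin.sum_univ_two] at h0 h1
    exact ⟨h0, h1⟩
  · rintro ⟨h0, h1⟩
    ext i
    fin_cases i
    · simpa [Matrix.mulVec, dotProduct, Fin.sum_univ_two] using h0
    · simpa [Matrix.mulVec, dotProduct, Fin.sum_univ_two] using h1

/-- **An eigenvalue of a parabolic matrix is half its trace** (the characteristic polynomial has the
double root `tr/2`). [cite: Shimura1971, §1.3] -/
theorem eigenvalue_eq_half_trace_of_isParabolic {P : Matrix (Fin 2) (Fin 2) ℝ} (hP : P.IsParabolic)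
    {x : Fin 2 → ℝ} (hx : x ≠ 0) {e : ℝ} (h : P *ᵥ x = e • x) : e = (P 0 0 + P 1 1) / 2 := by
  obtain ⟨h0, h1⟩ := (mulVec_eq_smul_iff P x e).mp h
  -- the characteristic polynomial vanishes at `e`
  have hchar : e ^ 2 - (P 0 0 + P 1 1) * e + (P 0 0 * P 1 1 - P 0 1 * P 1 0) = 0 := by
    have hd0 : (e ^ 2 - (P 0 0 + P 1 1) * e + (P 0 0 * P 1 1 - P 0 1 * P 1 0)) * x 0 = 0 := by
      linear_combination (P 1 1 - e) * h0 - P 0 1 * h1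
    have hd1 : (e ^ 2 - (P 0 0 + P 1 1) * e + (P 0 0 * P 1 1 - P 0 1 * P 1 0)) * x 1 = 0 := by
      linear_combination (P 0 0 - e) * h1 - P 1 0 * h0
    by_contra hne
    apply hx
    ext i
    fin_cases i
    · simpa using (mul_eq_zero.mp hd0).resolve_left hne
    · simpa using (mul_eq_zero.mp hd1).resolve_left hne
  -- the discriminant vanishes
  have hdisc : (P 0 0 + P 1 1) ^ 2 - 4 * (P 0 0 * P 1 1 - P 0 1 * P 1 0) = 0 := by
    have := hP.2
    rw [Matrix.discr_fin_two, Matrix.trace_fin_two, Matrix.det_fin_two] at this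
    linarith
  have hsq : (2 * e - (P 0 0 + P 1 1)) ^ 2 = 0 := by nlinarith [hchar, hdisc]
  have := pow_eq_zero_iff (two_ne_zero) |>.mp hsq
  linarith

/-- **Two eigenvectors of a non-scalar `2 × 2` matrix for the same eigenvalue are proportional**
(the eigenspace of a non-scalar matrix is a line). [cite: Shimura1971, §1.3] -/
theorem exists_smul_eq_of_mulVec_eq_smul {P : Matrix (Fin 2) (Fin 2) ℝ}
    (hP : P ∉ Set.range (Matrix.scalar (Fin 2) : ℝ →+* Matrix (Fin 2) (Fin 2) ℝ))
    {x y : Fin 2 → ℝ} (hx : x ≠ 0) {e : ℝ} (hPx : P *ᵥ x = e • x) (hPy : P *ᵥ y = e • y) :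
    ∃ c : ℝ, y = c • x := by
  obtain ⟨hx0, hx1⟩ := (mulVec_eq_smul_iff P x e).mp hPx
  obtain ⟨hy0, hy1⟩ := (mulVec_eq_smul_iff P y e).mp hPy
  -- the determinant `x ∧ y` vanishes, since `P - e` is a nonzero matrix killing `x` and `y`
  have hD : x 0 * y 1 - x 1 * y 0 = 0 := by
    by_contra hD
    have ha : (P 0 0 - e) * (x 0 * y 1 - x 1 * y 0) = 0 := by linear_combination y 1 * hx0 - x 1 * hy0
    have hb : P 0 1 * (x 0 * y 1 - x 1 * y 0) = 0 := by linear_combination x 0 * hy0 - y 0 * hx0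
    have hc : P 1 0 * (x 0 * y 1 - x 1 * y 0) = 0 := by linear_combination y 1 * hx1 - x 1 * hy1
    have hd : (P 1 1 - e) * (x 0 * y 1 - x 1 * y 0) = 0 := by linear_combination x 0 * hy1 - y 0 * hx1
    have ha' := (mul_eq_zero.mp ha).resolve_right hD
    have hb' := (mul_eq_zero.mp hb).resolve_right hD
    have hc' := (mul_eq_zero.mp hc).resolve_right hD
    have hd' := (mul_eq_zero.mp hd).resolve_right hD
    apply hP
    refine ⟨e, ?_⟩
    ext i j
    fin_cases i <;> fin_cases j <;> simp <;> linarith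
  -- so `y` is a multiple of `x ≠ 0`
  by_cases h0 : x 0 = 0
  · have h1 : x 1 ≠ 0 := by
      intro h1
      apply hx
      ext i
      fin_cases i
      · exact h0
      · exact h1
    refine ⟨y 1 / x 1, ?_⟩
    have hy0' : y 0 = 0 := by
      rw [h0, zero_mul, zero_sub, neg_eq_zero] at hD
      exact (mul_eq_zero.mp hD).resolve_left h1
    ext i
    fin_cases i
    · simp [h0, hy0']
    · simp [div_mul_cancel₀ _ h1]
  · refine ⟨y 0 / x 0, ?_⟩
    ext i
    fin_cases i
    · simp [div_mul_cancel₀ _ h0]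
    · simp only [Pi.smul_apply, smul_eq_mul, Fin.mk_one]
      field_simp
      linarith

/-- ★ **Parabolic powers of one matrix share their eigenline.**  If `Qⁿ¹` and `Qⁿ²` (`Q ∈ SL(2, ℝ)`,
`n₁, n₂ ∈ ℤ`) are both parabolic with eigenvectors `x₁ ≠ 0`, `x₂ ≠ 0`, then `x₂ = c x₁`: the two powers
commute, so `Qⁿ¹ x₂` lies in the eigenline `ℝ x₂` of `Qⁿ²`, i.e. `x₂` is an eigenvector of `Qⁿ¹`, whose
eigenline is `ℝ x₁`. [cite: Shimura1971, §1.3–1.5] -/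
theorem exists_smul_eq_of_zpow (Q : SL(2, ℝ)) {n₁ n₂ : ℤ} {x₁ x₂ : Fin 2 → ℝ}
    (hx₁ : x₁ ≠ 0) (hx₂ : x₂ ≠ 0)
    (h₁ : ((Q ^ n₁ : SL(2, ℝ)) : Matrix (Fin 2) (Fin 2) ℝ).IsParabolic)
    (h₂ : ((Q ^ n₂ : SL(2, ℝ)) : Matrix (Fin 2) (Fin 2) ℝ).IsParabolic)
    {e₁ e₂ : ℝ} (hQ₁ : ((Q ^ n₁ : SL(2, ℝ)) : Matrix (Fin 2) (Fin 2) ℝ) *ᵥ x₁ = e₁ • x₁)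
    (hQ₂ : ((Q ^ n₂ : SL(2, ℝ)) : Matrix (Fin 2) (Fin 2) ℝ) *ᵥ x₂ = e₂ • x₂) :
    ∃ c : ℝ, x₂ = c • x₁ := by
  set P₁ : Matrix (Fin 2) (Fin 2) ℝ := ((Q ^ n₁ : SL(2, ℝ)) : Matrix (Fin 2) (Fin 2) ℝ) with hP₁
  set P₂ : Matrix (Fin 2) (Fin 2) ℝ := ((Q ^ n₂ : SL(2, ℝ)) : Matrix (Fin 2) (Fin 2) ℝ) with hP₂
  have hcomm : P₁ * P₂ = P₂ * P₁ := by
    rw [hP₁, hP₂, ← Matrix.SpecialLinearGroup.coe_mul, ← Matrix.SpecialLinearGroup.coe_mul,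
      ← zpow_add, ← zpow_add, add_comm]
  -- `P₁ x₂` is an eigenvector of `P₂` for `e₂`, hence a multiple of `x₂`
  have hP₁x₂ : P₂ *ᵥ (P₁ *ᵥ x₂) = e₂ • (P₁ *ᵥ x₂) := by
    rw [Matrix.mulVec_mulVec, ← hcomm, ← Matrix.mulVec_mulVec, hQ₂, Matrix.mulVec_smul]
  obtain ⟨c, hc⟩ := exists_smul_eq_of_mulVec_eq_smul h₂.1 hx₂ hQ₂ hP₁x₂
  -- so `x₂` is an eigenvector of `P₁`; its eigenvalue and `e₁` are both `tr P₁ / 2`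
  have he₁ : e₁ = (P₁ 0 0 + P₁ 1 1) / 2 := eigenvalue_eq_half_trace_of_isParabolic h₁ hx₁ hQ₁
  have hc' : c = (P₁ 0 0 + P₁ 1 1) / 2 := eigenvalue_eq_half_trace_of_isParabolic h₁ hx₂ hc
  have hP₁x₂' : P₁ *ᵥ x₂ = e₁ • x₂ := by rw [hc, hc', he₁]
  exact exists_smul_eq_of_mulVec_eq_smul h₁.1 hx₁ hQ₁ hP₁x₂'

/-- Parabolicity is invariant under conjugation in `SL(2, ℝ)`. [cite: Shimura1971, §1.3] -/
theorem isParabolic_conj_sl (n t : SL(2, ℝ)) (ht : (t : Matrix (Fin 2) (Fin 2) ℝ).IsParabolic) :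
    ((n * t * n⁻¹ : SL(2, ℝ)) : Matrix (Fin 2) (Fin 2) ℝ).IsParabolic := by
  have hinv : ((n⁻¹ : SL(2, ℝ)) : Matrix (Fin 2) (Fin 2) ℝ) = (n : Matrix (Fin 2) (Fin 2) ℝ)⁻¹ := by
    rw [Matrix.SpecialLinearGroup.coe_inv, Matrix.inv_def, Matrix.SpecialLinearGroup.det_coe,
      Ring.inverse_one, one_smul]
  rw [Matrix.SpecialLinearGroup.coe_mul, Matrix.SpecialLinearGroup.coe_mul, hinv]
  exact (Matrix.isParabolic_conj_iff (Matrix.SpecialLinearGroup.toGL n)).mpr ht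

/-- `s v ≠ 0` for `s ∈ SL(2, ℝ)` and `v ≠ 0`. [cite: Shimura1971, §1.3] -/
theorem sl_mulVec_ne_zero (s : SL(2, ℝ)) {v : Fin 2 → ℝ} (hv : v ≠ 0) :
    (s : Matrix (Fin 2) (Fin 2) ℝ) *ᵥ v ≠ 0 := by
  intro h
  apply hv
  have : ((s⁻¹ * s : SL(2, ℝ)) : Matrix (Fin 2) (Fin 2) ℝ) *ᵥ v = v := by
    rw [inv_mul_cancel, Matrix.SpecialLinearGroup.coe_one, Matrix.one_mulVec]
  rw [← this, Matrix.SpecialLinearGroup.coe_mul, ← Matrix.mulVec_mulVec, h, Matrix.mulVec_zero]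

/-! ### §2 The chart end at a puncture, with its formula -/

section ChartEnd

variable {M : Type} [TopologicalSpace M] [T2Space M] [ChartedSpace ℂ M] [IsManifold 𝓘(ℂ, ℂ) ω M]

/-- The model end `g w = c₀ + (r/2) e^{2πiw}` is at distance `(r/2) e^{-2π Im w}` from `c₀`.
[folklore] -/
private theorem norm_modelEnd_sub' (c₀ : ℂ) {r : ℝ} (hr : 0 < r) (w : ℂ) :
    ‖(c₀ + ((r / 2 : ℝ) : ℂ) * exp (2 * π * I * w)) - c₀‖ = r / 2 * Real.exp (-2 * π * w.im) := by
  simp only [add_sub_cancel_left, norm_mul, Complex.norm_real, Real.norm_eq_abs,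
    abs_of_pos (half_pos hr), norm_exp_two_pi_I_mul]

/-- ★ **The chart end at a puncture, with its formula** (abc-iut-w6-d031's `exists_end_ofOpens_puncture`
with the data exported).  For a connected open `U ⊆ M` and a puncture `s ∉ U` (a punctured
neighbourhood of `s` lies in `U`), writing `φ` for the extended chart at `s`: there are `r > 0` with
`ball (φ s) r ⊆ φ.target`, `φ⁻¹` mapping the punctured ball into `U`, and a holomorphic `1`-periodic
`G : ℍ → U` with `G τ = φ⁻¹ (φ s + (r/2) e^{2πiτ})`.
[cite: FarkasKra1992, IV.5.5–IV.5.6] [cite: MochizukiAbsTopIII2015, Definition 4.1 (i) p.101] -/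
theorem exists_chartEnd (U : Opens M) (hU : IsConnected (U : Set M)) {s : M}
    (hpunct : ∃ V ∈ 𝓝 s, V \ {s} ⊆ (U : Set M)) :
    ∃ (r : ℝ) (G : ℍ → (ofOpens U hU).carrier), 0 < r ∧
      ball (extChartAt 𝓘(ℂ, ℂ) s s) r ⊆ (extChartAt 𝓘(ℂ, ℂ) s).target ∧
      (∀ z ∈ ball (extChartAt 𝓘(ℂ, ℂ) s s) r, z ≠ extChartAt 𝓘(ℂ, ℂ) s s →
        (extChartAt 𝓘(ℂ, ℂ) s).symm z ∈ (U : Set M)) ∧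
      MDifferentiable 𝓘(ℂ, ℂ) 𝓘(ℂ, ℂ) G ∧
      (∀ τ τ' : ℍ, (τ' : ℂ) = τ + 1 → G τ' = G τ) ∧
      ∀ τ : ℍ, (G τ).1 =
        (extChartAt 𝓘(ℂ, ℂ) s).symm (extChartAt 𝓘(ℂ, ℂ) s s + ((r / 2 : ℝ) : ℂ) * exp (2 * π * I * τ)) := by
  obtain ⟨V, hV, hVU⟩ := hpunct
  -- the chart at `s` and a small ball in its target
  set φ := extChartAt 𝓘(ℂ, ℂ) s with hφ
  set c₀ : ℂ := φ s with hc₀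
  have hc₀t : c₀ ∈ φ.target := mem_extChartAt_target s
  have htarget : IsOpen φ.target := isOpen_extChartAt_target s
  have hsymm_cont : ContinuousAt φ.symm c₀ := continuousAt_extChartAt_symm s
  have hsymm_c₀ : φ.symm c₀ = s := extChartAt_to_inv s
  have hpre : φ.symm ⁻¹' V ∈ 𝓝 c₀ := hsymm_cont (by rw [hsymm_c₀]; exact hV)
  obtain ⟨r, hr, hball⟩ := Metric.mem_nhds_iff.mp (inter_mem (htarget.mem_nhds hc₀t) hpre)
  -- the punctured ball maps into `U`
  have hballU : ∀ z ∈ ball c₀ r, z ≠ c₀ → φ.symm z ∈ (U : Set M) := by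
    intro z hz hzc
    refine hVU ⟨(hball hz).2, fun h => hzc ?_⟩
    exact φ.symm.injOn (hball hz).1 hc₀t (h.trans hsymm_c₀.symm)
  -- the model end
  let g : ℂ → ℂ := fun w => c₀ + ((r / 2 : ℝ) : ℂ) * exp (2 * π * I * w)
  have hg_diff : Differentiable ℂ g := by
    refine (differentiable_const _).add ((differentiable_const _).mul ?_)
    exact differentiable_exp.comp ((differentiable_const _).mul differentiable_id)
  have hg_ball : ∀ τ : ℍ, g τ ∈ ball c₀ r := fun τ => by
    rw [mem_ball, dist_eq_norm, norm_modelEnd_sub' c₀ hr]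
    have : Real.exp (-2 * π * (τ : ℂ).im) < 1 := by
      rw [← Real.exp_zero, Real.exp_lt_exp]
      have := τ.im_pos
      rw [← UpperHalfPlane.coe_im] at this
      nlinarith [Real.pi_pos]
    nlinarith
  have hg_ne : ∀ τ : ℍ, g τ ≠ c₀ := fun τ h => by
    have h0 : ‖g τ - c₀‖ = 0 := by rw [h, sub_self, norm_zero]
    rw [norm_modelEnd_sub' c₀ hr] at h0
    have := Real.exp_pos (-2 * π * (τ : ℂ).im)
    nlinarith
  have hg_t : ∀ τ : ℍ, g τ ∈ φ.target := fun τ => (hball (hg_ball τ)).1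
  have hmem : ∀ τ : ℍ, φ.symm (g τ) ∈ (U : Set M) := fun τ => hballU _ (hg_ball τ) (hg_ne τ)
  let G : ℍ → (ofOpens U hU).carrier := fun τ => ⟨φ.symm (g τ), hmem τ⟩
  have hG_val : ∀ τ : ℍ, (G τ).1 = φ.symm (g τ) := fun τ => rfl
  -- holomorphy of the `ℂ`-valued model end on `ℍ`
  have hg_md : MDifferentiable 𝓘(ℂ, ℂ) 𝓘(ℂ, ℂ) (fun τ : ℍ => g τ) := fun τ => by
    rw [UpperHalfPlane.mdifferentiableAt_iff]
    have h3 : (fun z : ℂ => g (UpperHalfPlane.ofComplex z)) =ᶠ[𝓝 (τ : ℂ)] g := by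
      filter_upwards [isOpen_upperHalfPlaneSet.mem_nhds τ.im_pos] with z hz
      have hz : 0 < z.im := hz
      rw [UpperHalfPlane.ofComplex_apply_of_im_pos hz, UpperHalfPlane.coe_mk]
    exact ((hg_diff _).congr_of_eventuallyEq h3 :)
  refine ⟨r, G, hr, fun z hz => (hball hz).1, hballU, fun τ => ?_, fun τ τ' h => ?_, fun τ => rfl⟩
  · -- holomorphy: `Subtype.val ∘ G = φ.symm ∘ g ∘ coe`
    have h1 : MDifferentiableAt 𝓘(ℂ, ℂ) 𝓘(ℂ, ℂ) (Subtype.val ∘ G) τ ↔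
        MDifferentiableAt 𝓘(ℂ, ℂ) 𝓘(ℂ, ℂ) G τ :=
      ChartedSpace.liftPropWithinAt_subtypeVal_comp_iff ..
    rw [← h1]
    have h2 : (Subtype.val ∘ G) = (fun c => φ.symm c) ∘ (fun τ : ℍ => g τ) := funext fun τ => rfl
    rw [h2]
    have hsymm_md : MDifferentiableAt 𝓘(ℂ, ℂ) 𝓘(ℂ, ℂ) (fun c => φ.symm c) (g τ) :=
      ((contMDiffOn_extChartAt_symm (I := 𝓘(ℂ, ℂ)) (n := ω) s).mdifferentiableOn (by simp) _
        (hg_t τ)).mdifferentiableAt (htarget.mem_nhds (hg_t τ))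
    exact hsymm_md.comp τ (hg_md τ)
  · -- `1`-periodicity
    apply Subtype.ext
    rw [hG_val, hG_val]
    show φ.symm (c₀ + ((r / 2 : ℝ) : ℂ) * exp (2 * π * I * τ')) =
      φ.symm (c₀ + ((r / 2 : ℝ) : ℂ) * exp (2 * π * I * τ))
    rw [h, mul_add, mul_one, Complex.exp_add, Complex.exp_two_pi_mul_I, mul_one]

end ChartEnd

/-! ### §3 Integer monodromy of a lifted end -/

/-- **Integer monodromy**: if `F̃ (τ + 1) = q • F̃ τ` for all `τ`, then `F̃ (τ + n) = qⁿ • F̃ τ` for every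
`n ∈ ℤ` (induction upward; downward from `F̃ τ = q • F̃ (τ - 1)`). [cite: FarkasKra1992, IV.5.5–IV.5.6] -/
theorem smul_zpow_of_deck {Ft : ℍ → ℍ} {q : PSL2R}
    (hdeck : ∀ τ τ' : ℍ, (τ' : ℂ) = τ + 1 → Ft τ' = q • Ft τ) :
    ∀ (n : ℤ) (τ τ' : ℍ), (τ' : ℂ) = τ + n → Ft τ' = q ^ n • Ft τ := by
  -- translation by a real number inside `ℍ`
  have hmk : ∀ (τ : ℍ) (x : ℝ), ∃ σ : ℍ, (σ : ℂ) = τ + x := fun τ x =>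
    ⟨UpperHalfPlane.mk ((τ : ℂ) + x) (by simpa using τ.im_pos), rfl⟩
  intro n
  induction n using Int.induction_on with
  | zero =>
    intro τ τ' h
    rw [Int.cast_zero, add_zero] at h
    rw [zpow_zero, one_smul, UpperHalfPlane.ext h]
  | succ n ih =>
    intro τ τ' h
    obtain ⟨σ, hσ⟩ := hmk τ n
    have h1 : (τ' : ℂ) = σ + 1 := by rw [h, hσ]; push_cast; ring
    rw [hdeck σ τ' h1, ih τ σ hσ, smul_smul, ← zpow_one_add, add_comm]
  | pred n ih =>
    intro τ τ' h
    -- `τ' + 1 = τ + (-n)`, so `F̃ (τ + (-n)) = q • F̃ τ'`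
    obtain ⟨σ, hσ⟩ := hmk τ' 1
    have h1 : (σ : ℂ) = τ + ((-(n : ℤ) : ℤ) : ℂ) := by
      rw [hσ, h]; push_cast; ring
    have h2 : Ft σ = q • Ft τ' := hdeck τ' σ (by rw [hσ]; push_cast; ring)
    have h3 : Ft σ = q ^ (-(n : ℤ)) • Ft τ := ih τ σ h1
    have h4 : Ft τ' = q⁻¹ • Ft σ := by rw [h2, inv_smul_smul]
    rw [h4, h3, smul_smul, ← zpow_neg_one, ← zpow_add]
    congr 1
    ring

end HolRS

end Literature.AnabelianGeometry.AbsoluteAnabelian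

end
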